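import Summits.BirchSwinnertonDyer.BirchSwinnertonDyer.Theorems.QuadraticBranchSignedControlPlusEtaNonsurjThetaFunctionalEquationExactBranch
import HarnessLib

/-!
# Route `QuadraticBranchSignedControl` (rung K8, cell `bsd-potss`), residual crux `PlusEtaMainConjectureNonsurj`
# (stmt-BirchSwinnertonDyer-19606): THE FUNCTIONAL EQUATION ON THE QUADRATIC BRANCH, XIII — THE LINEAR FACTORS OF `L_p^±(V, η, X)` COME IN
# `ι`-PAIRS: `(T − c) ∣ L ⟺ (T − c^ι) ∣ L`, `(1+c)(1+c^ι) = 1`; only `c = 0` is self-paired (seat `bsd-potss-k8eta-c2` g28; kernel, class-wide)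

WHY. The exact functional equation `ι L = w·(1+T)^e·L` of Parts IX–X (p763122, p763347) moves the degree-one distinguished factors of a
branch function around: `ι(T − c) = −(1+c)·(1+T)⁻¹·(T − c^ι)` with `c^ι = (1+c)⁻¹ − 1` (the point `T = c` of the open unit disc and its
image under `s ↦ 2 − s` / `χ ↦ χ⁻¹`). Hence **`(T − c) ∣ L_p^±(V, η, X)` iff `(T − c^ι) ∣ L_p^±(V, η, X)`** for every `c ∈ ℤ_p` with a partner
`c^ι` (`(1+c)(1+c^ι) = 1`, automatic for `c ∈ pℤ_p`): the `ℚ_p`-rational zeros of a branch function in the open disc come in `ι`-PAIRS, and for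
`p` odd the only self-paired point of `pℤ_p` is `c = 0` (`(1+c)² = 1 ⇒ c ∈ {0, −2}`). This is the analytic half — now a THEOREM with no named
fact — of the mechanism of k8eta-c1's functional-equation squeeze for crux 19601 (`…PlusEtaLowerInclusionFunctionalEquationSqueeze`, g11:
"the two extra zeros of `L_p⁺(V,η,X)` are `ℚ_p`-rational, non-classical points `T = c₁, c₂` of the cyclotomic line, swapped by `s ↦ −s`";
its residue row `69150v1` at `p = 5` displays `c₁ ≡ 10`, `c₂ ≡ 15 (mod 25)`, and indeed `(1+10)(1+15) = 176 ≡ 1 (mod 25)`), whose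
ALGEBRAIC half is B. D. Kim's Thm. 3.11 (named fact `Kim2008.thm311_…`).

MATHEMATICS. `(ι(T − c))·(1+T) = 1 − (1 + c)(1+T) = −(1+c)·T − c = −(1+c)·(T − c^ι)` using `(1+c)c^ι = −c`; so `ι(T − c) = −(1+c)·E·(T − c^ι)`,
`E = (1+T)⁻¹ = 1 + ιT`. If `L = (T − c)·K` then `w(1+T)^e L = ι L = −(1+c)E(T − c^ι)·ιK`, and `w(1+T)^e` is invertible
(`w² = 1`, `(1+T)^e(1+T)^{−e} = 1`), so `(T − c^ι) ∣ L`; the converse is the same statement for the pair `(c^ι, c)`.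

WHAT. §28 `invol_X_sub_C_mul` (the identity), `X_sub_C_dvd_of_invol_eq` / `X_sub_C_dvd_iff_of_invol_eq` (generic, exact FE with `w² = 1`),
`eq_zero_of_self_paired` (`(1+c)² = 1`, `‖c‖ < 1`, `p` odd ⇒ `c = 0`), `exists_partner_of_norm_lt_one` (`c ∈ pℤ_p` has a partner);
§29 **`X_sub_C_dvd_iff_of_isQuadraticBranch{Plus,Minus}LFunction`** (any period ratio; no sign / exponent in the statement), row currency
`X_sub_C_dvd_iff_plus_row`.

HONEST FRAMING (cell `bsd-potss`; FULL-BSD rank ≤ 1 programme, HUMAN RULING D-0036/D-0074): TOOL THEOREMS ONLY — no definition, no named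
fact, no `sorry`, axioms standard; nothing about (A), (C1⁺_η), (E⁺_η), C-cc-1 or `BSD(W,p)` of any pair is claimed; no stub of 19606 (or 19601)
is proved; crux and route OPEN; nothing booked. `--supports stmt-BirchSwinnertonDyer-19606`.

References: [MazurTateTeitelbaum1986Invent] §I.17; [GreenbergLNM1716] §5 (p. 181: the root pairing `a ↔ (1+a)⁻¹ − 1`, "`a = 0`");
[Sprung2017] Cor. 4.14; [Washington1997] §7.1, §13.2. Tree: Parts IX–X; `…PlusEtaLowerInclusionFunctionalEquationSqueezeAlgebra`
(`not_associated_invol_X_sub_C`, k8eta-c1 g11 — the self-pairing obstruction for ONE lone factor).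
-/

set_option autoImplicit false
set_option linter.dupNamespace false
noncomputable section

open scoped Classical MatrixGroups ModularForm

open CongruenceSubgroup Polynomial WeierstrassCurve Literature.NumberTheory.EllipticCurves
  Literature.NumberTheory.EllipticCurves.ModularForms
open Literature.NumberTheory.EllipticCurves.IwasawaAlgebra
open Summit.BirchSwinnertonDyer.Rank1Residual.Additive

namespace Summit.BirchSwinnertonDyer.BirchSwinnertonDyer.Theorems.EtaThetaFunctionalEquation

variable {p : ℕ} [hp : Fact p.Prime]

/-! ## §28 `ι(T − c) = −(1+c)·(1+T)⁻¹·(T − c^ι)` and the transfer of linear factors through an exact functional equation -/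

/-- **`ι(T − c) = −(1+c)·E·(T − c^ι)`** in `Λ`, `E = 1 + ιT = (1+T)⁻¹`, for partners `(1+c)(1+c^ι) = 1` (so `c^ι = (1+c)⁻¹ − 1`).
[cite: GreenbergLNM1716, §5 (p. 181)] [cite: Washington1997, §13.2] -/
theorem invol_X_sub_C_mul {c c' : ℤ_[p]} (hcc : (1 + c) * (1 + c') = 1) :
    invol p (PowerSeries.X - PowerSeries.C c) =
      -PowerSeries.C (1 + c) * (1 + invSubOne p) * (PowerSeries.X - PowerSeries.C c') := by
  have hUE : (1 + PowerSeries.X : PowerSeries ℤ_[p]) * (1 + invSubOne p) = 1 := one_add_X_mul_one_add_invSubOne p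
  have hC : PowerSeries.C (1 + c) * PowerSeries.C (1 + c') = (1 : PowerSeries ℤ_[p]) := by rw [← map_mul, hcc, map_one]
  rw [map_add, map_add, map_one] at hC
  rw [map_sub, invol_X, invol_C, map_add, map_one]
  linear_combination (1 + PowerSeries.C c) * hUE - (1 + invSubOne p) * hC

/-- **Transfer of a linear factor through an exact functional equation**: if `ι L = w·(1+T)^e·L` with `w² = 1` and `(T − c) ∣ L`, then
`(T − c^ι) ∣ L` for the partner `c^ι` (`(1+c)(1+c^ι) = 1`). [cite: GreenbergLNM1716, §5 (p. 181)] [cite: MazurTateTeitelbaum1986Invent, §I.17] -/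
theorem X_sub_C_dvd_of_invol_eq {L : PowerSeries ℤ_[p]} {w e : ℤ_[p]} (hw : w * w = 1)
    (hFE : invol p L = PowerSeries.C w * PowerSeries.binomialSeries ℤ_[p] e * L) {c c' : ℤ_[p]} (hcc : (1 + c) * (1 + c') = 1)
    (h : PowerSeries.X - PowerSeries.C c ∣ L) : PowerSeries.X - PowerSeries.C c' ∣ L := by
  obtain ⟨K, hK⟩ := h
  have hBB : PowerSeries.binomialSeries ℤ_[p] (-e) * PowerSeries.binomialSeries ℤ_[p] e = (1 : PowerSeries ℤ_[p]) := by
    rw [← PowerSeries.binomialSeries_add, neg_add_cancel, PowerSeries.binomialSeries_zero]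
  have hww : PowerSeries.C w * PowerSeries.C w = (1 : PowerSeries ℤ_[p]) := by rw [← map_mul, hw, map_one]
  -- `L = (C w · (1+T)^{−e}) · ι L` and `ι L = ι(T − c) · ι K`
  have hL : L = PowerSeries.C w * PowerSeries.binomialSeries ℤ_[p] (-e) * invol p L := by
    rw [hFE]; linear_combination (-(PowerSeries.binomialSeries ℤ_[p] (-e) * PowerSeries.binomialSeries ℤ_[p] e * L)) * hww -
      L * hBB
  refine ⟨PowerSeries.C w * PowerSeries.binomialSeries ℤ_[p] (-e) * (-PowerSeries.C (1 + c) * (1 + invSubOne p) * invol p K), ?_⟩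
  conv_lhs => rw [hL, hK, map_mul, invol_X_sub_C_mul hcc]
  ring

/-- **`(T − c) ∣ L ⟺ (T − c^ι) ∣ L`** under an exact functional equation with `w² = 1` (the partner relation is symmetric).
[cite: GreenbergLNM1716, §5 (p. 181)] [cite: MazurTateTeitelbaum1986Invent, §I.17] -/
theorem X_sub_C_dvd_iff_of_invol_eq {L : PowerSeries ℤ_[p]} {w e : ℤ_[p]} (hw : w * w = 1)
    (hFE : invol p L = PowerSeries.C w * PowerSeries.binomialSeries ℤ_[p] e * L) {c c' : ℤ_[p]} (hcc : (1 + c) * (1 + c') = 1) :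
    PowerSeries.X - PowerSeries.C c ∣ L ↔ PowerSeries.X - PowerSeries.C c' ∣ L :=
  ⟨X_sub_C_dvd_of_invol_eq hw hFE hcc, X_sub_C_dvd_of_invol_eq hw hFE (by rw [mul_comm]; exact hcc)⟩

/-- **Only `c = 0` is self-paired** (`p` odd): `(1+c)² = 1` and `‖c‖ < 1` force `c = 0` (`c(c+2) = 0` and `‖c + 2‖ = 1`) — the root pairing
`a ↔ (1+a)⁻¹ − 1` has the sole fixed point `0` in the open disc. [cite: GreenbergLNM1716, §5 (p. 181: "a = 0")] -/
theorem eq_zero_of_self_paired (hp2 : p ≠ 2) {c : ℤ_[p]} (hc : ‖c‖ < 1) (hcc : (1 + c) * (1 + c) = 1) : c = 0 := by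
  have hP : p.Prime := hp.out
  have h1 : c * (c + 2) = 0 := by linear_combination hcc
  rcases mul_eq_zero.mp h1 with h | h
  · exact h
  · exfalso
    -- `‖2‖ = 1` for `p` odd, but `2 = (c + 2) − c` has norm `< 1`
    have h2 : ‖(2 : ℤ_[p])‖ = 1 := by
      rw [show (2 : ℤ_[p]) = ((2 : ℕ) : ℤ_[p]) by norm_cast, PadicInt.norm_natCast_eq_one_iff]
      exact (Nat.coprime_primes hP Nat.prime_two).mpr hp2
    have h3 : (2 : ℤ_[p]) = (c + 2) - c := by ring
    have h4 : ‖(2 : ℤ_[p])‖ < 1 := by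
      rw [h3, h, zero_sub, norm_neg]; exact hc
    rw [h2] at h4
    exact lt_irrefl _ h4

/-- Every `c` in the open disc (`‖c‖ < 1`) has a partner: `(1+c)(1+c^ι) = 1` for some `c^ι` (`1 + c ∈ ℤ_pˣ`). [folklore] -/
theorem exists_partner_of_norm_lt_one {c : ℤ_[p]} (hc : ‖c‖ < 1) : ∃ c' : ℤ_[p], (1 + c) * (1 + c') = 1 := by
  have hu : IsUnit (1 + c) := by
    rw [PadicInt.isUnit_iff]
    refine le_antisymm (PadicInt.norm_le_one _) (le_of_not_gt fun hlt ↦ ?_)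
    have h3 := PadicInt.nonarchimedean (1 + c) (-c)
    rw [add_neg_cancel_right, norm_neg, norm_one] at h3
    exact absurd h3 (not_le.mpr (max_lt hlt hc))
  refine ⟨↑hu.unit⁻¹ - 1, ?_⟩
  rw [add_sub_cancel, IsUnit.mul_val_inv]

/-! ## §29 On the quadratic branch: the linear factors of every `L_p^±(V, η, X)` come in `ι`-pairs -/

section Branch

variable {N : ℕ} [NeZero N] {f : CuspForm (Gamma0 N) 2}

/-- **THE LINEAR FACTORS OF `L_p⁺(V, η, X)` COME IN `ι`-PAIRS**: for `p` odd, `f` a rational newform of level `N` prime to `p` with `a_p(f) = 0`,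
any period ratio `ϖ`, every plus branch function `L` (`IsQuadraticBranchPlusLFunction f p ϖ L`) and every pair `(1+c)(1+c^ι) = 1` in `ℤ_p`:
`(T − c) ∣ L ⟺ (T − c^ι) ∣ L`. No sign, exponent, `μ`, image, CM or rank hypothesis. [cite: GreenbergLNM1716, §5 (p. 181)]
[cite: MazurTateTeitelbaum1986Invent, §I.17] [cite: Kobayashi2003, Thm. 3.2, (3.4)] -/
theorem X_sub_C_dvd_iff_of_isQuadraticBranchPlusLFunction (hp2 : p ≠ 2) (hf0 : IsNewform0 f) (hQ : coeffField f = ⊥)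
    (hpN : ¬ p ∣ N) (hap : cuspCoeff f p = ((0 : ℤ) : ℂ)) {ϖ : ℚ} {L : IwasawaAlgebra p}
    (hL : IsQuadraticBranchPlusLFunction f p ϖ L) {c c' : ℤ_[p]} (hcc : (1 + c) * (1 + c') = 1) :
    PowerSeries.X - PowerSeries.C c ∣ L ↔ PowerSeries.X - PowerSeries.C c' ∣ L := by
  obtain ⟨σ, hσ, hW⟩ := exists_frickeSign_of_isNewform0 hf0
  obtain ⟨e, he⟩ := exists_invol_eq_of_isQuadraticBranchPlusLFunction hp2 hf0 hQ hpN hap hσ hW hL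
  refine X_sub_C_dvd_iff_of_invol_eq ?_ he hcc
  rcases sign_eq_one_or hpN hσ with h | h <;> rw [h] <;> simp

/-- **THE LINEAR FACTORS OF `L_p⁻(V, η, X)` COME IN `ι`-PAIRS** (minus twin). [cite: GreenbergLNM1716, §5 (p. 181)]
[cite: MazurTateTeitelbaum1986Invent, §I.17] [cite: Kobayashi2003, Thm. 3.2, (3.5)] -/
theorem X_sub_C_dvd_iff_of_isQuadraticBranchMinusLFunction (hp2 : p ≠ 2) (hf0 : IsNewform0 f) (hQ : coeffField f = ⊥)
    (hpN : ¬ p ∣ N) (hap : cuspCoeff f p = ((0 : ℤ) : ℂ)) {ϖ : ℚ} {L : IwasawaAlgebra p}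
    (hL : IsQuadraticBranchMinusLFunction f p ϖ L) {c c' : ℤ_[p]} (hcc : (1 + c) * (1 + c') = 1) :
    PowerSeries.X - PowerSeries.C c ∣ L ↔ PowerSeries.X - PowerSeries.C c' ∣ L := by
  obtain ⟨σ, hσ, hW⟩ := exists_frickeSign_of_isNewform0 hf0
  obtain ⟨e, he⟩ := exists_invol_eq_of_isQuadraticBranchMinusLFunction hp2 hf0 hQ hpN hap hσ hW hL
  refine X_sub_C_dvd_iff_of_invol_eq ?_ he hcc
  rcases sign_eq_one_or hpN hσ with h | h <;> rw [h] <;> simp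

end Branch

section Row

variable {N : ℕ} [NeZero N] {f : CuspForm (Gamma0 N) 2}

/-- **AT A ROW (plus)**: `V` globally minimal, good at `p ≥ 5`, `a_p(V) = 0`, `f` its newform (any level), any `ϖ`, every plus branch
function `Lη`, every pair `(1+c)(1+c^ι) = 1`: `(T − c) ∣ Lη ⟺ (T − c^ι) ∣ Lη`. Hypothesis-free beyond the row data.
[cite: GreenbergLNM1716, §5 (p. 181)] [cite: MazurTateTeitelbaum1986Invent, §I.17] -/
theorem X_sub_C_dvd_iff_plus_row (hp5 : 5 ≤ p) (V : WeierstrassCurve ℚ) [V.IsElliptic] [V.IsGloballyMinimal]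
    (hgood : V.HasGoodReductionAtPrime p) (hap : V.frobeniusTrace p = 0) (hf : IsNewformOf V f) (ϖ : ℚ) {Lη : IwasawaAlgebra p}
    (hL : IsQuadraticBranchPlusLFunction f p ϖ Lη) {c c' : ℤ_[p]} (hcc : (1 + c) * (1 + c') = 1) :
    PowerSeries.X - PowerSeries.C c ∣ Lη ↔ PowerSeries.X - PowerSeries.C c' ∣ Lη := by
  have hp2 : p ≠ 2 := by omega
  have hap' : cuspCoeff f p = ((0 : ℤ) : ℂ) := by
    rw [cuspCoeff_eq_frobeniusTrace_of_isNewformOf_holds hf hgood, hap]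
  exact X_sub_C_dvd_iff_of_isQuadraticBranchPlusLFunction hp2 hf.1 hf.coeffField_eq_bot (not_dvd_level_of_isNewformOf hf hgood)
    hap' hL hcc

/-- **AT A ROW (minus)**. [cite: GreenbergLNM1716, §5 (p. 181)] [cite: MazurTateTeitelbaum1986Invent, §I.17] -/
theorem X_sub_C_dvd_iff_minus_row (hp5 : 5 ≤ p) (V : WeierstrassCurve ℚ) [V.IsElliptic] [V.IsGloballyMinimal]
    (hgood : V.HasGoodReductionAtPrime p) (hap : V.frobeniusTrace p = 0) (hf : IsNewformOf V f) (ϖ : ℚ) {Lη : IwasawaAlgebra p}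
    (hL : IsQuadraticBranchMinusLFunction f p ϖ Lη) {c c' : ℤ_[p]} (hcc : (1 + c) * (1 + c') = 1) :
    PowerSeries.X - PowerSeries.C c ∣ Lη ↔ PowerSeries.X - PowerSeries.C c' ∣ Lη := by
  have hp2 : p ≠ 2 := by omega
  have hap' : cuspCoeff f p = ((0 : ℤ) : ℂ) := by
    rw [cuspCoeff_eq_frobeniusTrace_of_isNewformOf_holds hf hgood, hap]
  exact X_sub_C_dvd_iff_of_isQuadraticBranchMinusLFunction hp2 hf.1 hf.coeffField_eq_bot (not_dvd_level_of_isNewformOf hf hgood)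
    hap' hL hcc

end Row

end Summit.BirchSwinnertonDyer.BirchSwinnertonDyer.Theorems.EtaThetaFunctionalEquation

end
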